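import Summits.HodgeConjecture.HodgeConjecture.Theorems.Ring2HypothesesDescentMotivatedCupProduct
import Summits.HodgeConjecture.HodgeConjecture.Theorems.Ring2HypothesesDescentMotivatedCorrespondences
import HarnessLib

/-!
# Ring 2 hypotheses, descent face — André's Corollaire to Prop. 2.1 on the real carriers: external
# products and COMPOSITES of motivated correspondences are motivated

research route conditional on HC_CM; not a corollary; Q11.4-sentence-2 already refuted in dim ≥ 3.
Cell `pub-hodge-ring2` (Hodge ladder STAGE 3), seat `ring2-b05` (binder row b05
`Ring2.Hypotheses.MotivatedImpliesAlgebraicAV`), gen 35. `HC_CM` (`Theses.RankFourFaces.CMAbelianHodge`) does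
not occur in this file; nothing here proves a case of the Hodge conjecture; the row b05 stays OPEN.

André 1996, §2.1, Définition 2 and Corollaire (p. 15): «Une `E`-correspondance motivée de `X` vers `Y` de degré `r`
est un élément de `A_mot^{dim X + r}(X × Y)_E` … Les correspondances motivées se composent, leurs degrés
s'additionnant. En particulier, `C_mot⁰(X, X)_E` est une `E`-algèbre graduée. En effet … la proposition précédente
montre alors que les espaces de `E`-correspondances motivées sont stables par la composition donnée par la
formule `g ∘ f = pr^{XYZ}_{XZ*}(pr^{XYZ*}_{XY} f ∪ pr^{XYZ*}_{YZ} g)`.» With Prop. 2.1 (i) now a theorem of the real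
carriers (`cupProduct_mem_motivatedClasses`, previous file) and Prop. 2.1 (ii) / the graph formalism
(`Theorems.map_mem_motivatedClasses`, `Ring2.Hypotheses.complexGysin_mem_motivatedClasses`), both statements are
short compositions:

* `cross_mem_motivatedClasses` — **`A_motᵖ(X)_ℂ ⊠ A_mot^{p'}(Y)_ℂ ⊆ A_mot^{p+p'}(X ⊗ Y)_ℂ`** (external products);
* `corrCompClass_mem_motivatedClasses` — **the composite `p₁₃_*(p₁₂^* γ ∪ p₂₃^* γ')` of motivated correspondence
  classes `γ ∈ A_mot(X ⊗ Y)_ℂ`, `γ' ∈ A_mot(Y ⊗ Z)_ℂ` is a motivated class of `X ⊗ Z`** (Fulton's composite, the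
  shape of the tree's `HodgeTheory.corrCompClass_mem_algebraicClasses` for algebraic correspondences).

No definition, no named fact, no sorry. References: Andre1996Motifs (§2.1 Déf. 2 and Corollaire, p. 15),
Fulton1998 (§16.1 Def. 16.1.1), VoisinHodgeII2003 (§9.2.4 Prop. 9.20–9.21).
-/

noncomputable section

-- every declaration of this problem lives in `Summit.HodgeConjecture.HodgeConjecture.…` (summit = sub-problem)
set_option linter.dupNamespace false

open CategoryTheory AlgebraicGeometry MonoidalCategory CartesianMonoidalCategory
open Literature.AlgebraicTopology.SingularHomology Literature.Geometry.Kaehler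
open Literature.AlgebraicGeometry Literature.AlgebraicGeometry.Motives
  Literature.AlgebraicGeometry.HodgeTheory

namespace Summit.HodgeConjecture.HodgeConjecture.Theorems

variable {l m n : ℕ} {X Y Z : SchemeOver ℂ}

/-- **External products of motivated classes are motivated: `A_motᵖ(X)_ℂ ⊠ A_mot^{p'}(Y)_ℂ ⊆ A_mot^{p+p'}(X ⊗ Y)_ℂ`**
(`x ⊠ y = fst^* x ∪ snd^* y`; both pull-backs are motivated by Prop. 2.1 (ii), first inclusion, and the cup product
by Prop. 2.1 (i)). [cite: Andre1996Motifs, Prop. 2.1 (p. 14)] -/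
theorem cross_mem_motivatedClasses (hX : IsSmoothProjective n X) (hY : IsSmoothProjective m Y) {p p' r : ℕ}
    (h : 2 * p + 2 * p' = 2 * r) {x : complexBetti X (2 * p)} (hx : x ∈ motivatedClasses n X p)
    {y : complexBetti Y (2 * p')} (hy : y ∈ motivatedClasses m Y p') :
    cupProduct h (complexBetti.map (fst X Y) (2 * p) x) (complexBetti.map (snd X Y) (2 * p') y) ∈
      motivatedClasses (n + m) (X ⊗ Y) r :=
  cupProduct_mem_motivatedClasses (IsSmoothProjective.tensor_holds hX hY) h (map_fst_mem_motivatedClasses hX hY p hx)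
    (map_snd_mem_motivatedClasses hY hX p' hy)

/-- **Motivated correspondences compose** (André 1996, Corollaire p. 15: «Les correspondances motivées se
composent»; Fulton §16.1 Def. 16.1.1 `β ∘ α = p_{XZ*}(p_{XY}^* α · p_{YZ}^* β)`): for smooth projective `X`, `Y`, `Z`
of dimensions `l`, `m`, `n`, motivated correspondence classes `γ ∈ A_motᵉ(X ⊗ Y)_ℂ`, `γ' ∈ A_mot^{e'}(Y ⊗ Z)_ℂ` and
`e + e' = e'' + m`, the composite class `p₁₃_*(p₁₂^* γ ∪ p₂₃^* γ') ∈ H^{2e''}((X ⊗ Z)(ℂ); ℂ)`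
(`p₁₂ = X ◁ fst`, `p₂₃ = snd`, `p₁₃ = X ◁ snd` on `X ⊗ (Y ⊗ Z)`, `p₁₃_* = complexGysin μ` for any orientation
family `μ`) is a motivated class of `X ⊗ Z`: the pull-backs are motivated (`Theorems.map_mem_motivatedClasses`),
the cup product is motivated (Prop. 2.1 (i), `cupProduct_mem_motivatedClasses`) and the proper push-forward
preserves motivated classes (`Ring2.Hypotheses.complexGysin_mem_motivatedClasses`, the transposed graph being
algebraic). [cite: Andre1996Motifs, §2.1 Déf. 2 and Corollaire (p. 15)] [cite: Fulton1998, §16.1 Def. 16.1.1] -/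
theorem corrCompClass_mem_motivatedClasses (μ : OrientationFamily) (hX : IsSmoothProjective l X)
    (hY : IsSmoothProjective m Y) (hZ : IsSmoothProjective n Z) {e e' e'' : ℕ} (he : e + e' = e'' + m)
    {γ : complexBetti (X ⊗ Y) (2 * e)} (hγ : γ ∈ motivatedClasses (l + m) (X ⊗ Y) e)
    {γ' : complexBetti (Y ⊗ Z) (2 * e')} (hγ' : γ' ∈ motivatedClasses (m + n) (Y ⊗ Z) e') :
    complexGysin μ (IsSmoothProjective.tensor_holds hX (IsSmoothProjective.tensor_holds hY hZ))
        (IsSmoothProjective.tensor_holds hX hZ) (X ◁ snd Y Z)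
        (show 2 * (e + e') + 2 * (l + n) = 2 * e'' + 2 * (l + (m + n)) by omega)
        (cupProduct ((Nat.mul_add 2 e e').symm : 2 * e + 2 * e' = 2 * (e + e'))
          (complexBetti.map (X ◁ fst Y Z) (2 * e) γ) (complexBetti.map (snd X (Y ⊗ Z)) (2 * e') γ')) ∈
      motivatedClasses (l + n) (X ⊗ Z) e'' := by
  have hYZ := IsSmoothProjective.tensor_holds hY hZ
  have hT := IsSmoothProjective.tensor_holds hX hYZ
  have hXZ := IsSmoothProjective.tensor_holds hX hZ
  -- above the top degree of `X ⊗ Z` everything vanishes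
  by_cases hlt : l + n < e''
  · haveI := subsingleton_complexBetti hXZ (show 2 * (l + n) < 2 * e'' by omega)
    rw [Subsingleton.elim (complexGysin μ hT hXZ (X ◁ snd Y Z) _ _) 0]
    exact Submodule.zero_mem _
  have ha : complexBetti.map (X ◁ fst Y Z) (2 * e) γ ∈ motivatedClasses (l + (m + n)) (X ⊗ (Y ⊗ Z)) e :=
    map_mem_motivatedClasses (X ◁ fst Y Z) (IsSmoothProjective.tensor_holds hX hY) hT e hγ
  have hb : complexBetti.map (snd X (Y ⊗ Z)) (2 * e') γ' ∈ motivatedClasses (l + (m + n)) (X ⊗ (Y ⊗ Z)) e' :=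
    map_mem_motivatedClasses (snd X (Y ⊗ Z)) hYZ hT e' hγ'
  exact Ring2.Hypotheses.complexGysin_mem_motivatedClasses μ hT hXZ (X ◁ snd Y Z) _ (by omega)
    (cupProduct_mem_motivatedClasses hT _ ha hb)

/-- **Motivated correspondences act on motivated correspondences**: for `u ∈ A_mot(W ⊗ X)_ℂ` the map
`u^* = pr_{W*}(pr_X^*(·) ∪ u) : H²ᵖ(X(ℂ); ℂ) → H^{2p'}(W(ℂ); ℂ)` carries `A_motᵖ(X)_ℂ` into `A_mot^{p'}(W)_ℂ`, in
`Submodule.map` form (`corrClassAction_mem_motivatedClasses_of_motivated`). [cite: Andre1996Motifs, §2.1 Corollaire (p. 15)] -/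
theorem map_corrClassAction_motivatedClasses_le {W : SchemeOver ℂ} (hW : IsSmoothProjective m W)
    (hX : IsSmoothProjective n X) (μ : HomologicalOrientation ℂ (ComplexPoints (W ⊗ X)) (2 * (m + n)))
    (ν : HomologicalOrientation ℂ (ComplexPoints W) (2 * m)) (hμ : μ.HasPoincareDuality) (hν : ν.HasPoincareDuality)
    {e p p' q : ℕ} (hab : 2 * p + 2 * e = 2 * p' + 2 * n) (hq : 2 * p' + 2 * q = 2 * m)
    {u : complexBetti (W ⊗ X) (2 * e)} (hu : u ∈ motivatedClasses (m + n) (W ⊗ X) e) :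
    (motivatedClasses n X p).map (corrClassAction μ ν hab hq u) ≤ motivatedClasses m W p' := by
  rintro _ ⟨c, hc, rfl⟩
  exact corrClassAction_mem_motivatedClasses_of_motivated hW hX μ ν hμ hν hab hq hu hc

end Summit.HodgeConjecture.HodgeConjecture.Theorems

end
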